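import Summits.QuantumFields.YangMills.Theorems.BalabanUVNodesN15FullPropagatorEntry2Rows
import Summits.QuantumFields.YangMills.Theorems.BalabanUVNodesN15BackgroundPairSpace
import HarnessLib

/-!
# Route «BalabanUVNodes» (K4 «SpineRates»), node N15 = NE2, BACKGROUND LAYER — THE ENTRY-2 DEVICE AT BAŁABAN's FULL `U ≡ 1` PROPAGATOR, part 2: the RIGHT fixed point of
# the lineage's constructed propagator (`X̂ = Ĝ + X̂V̂Ĝ`, `E₀ = G + E₀W`) and ★★ THE η-DEFECT OF THE BY-PARTS DRESSED ENTRY 2 `G(U)∇*` ON THE TORUS FAMILY, modulo the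
# `U ≡ 1` entry-2 defect (dag-n15-a) and the species' letters — NO MIXED PIECE `∇G∇*`

Cell `pub-ymgap`, seat `pub-ymgap-dag-n15-c` (generation g8; R134 ACCELERATION SEAT, strategy s1; HUMAN RULING D-0062; chair R424 venue; `bears_on: R4∕N15`).  Filed
`--kind proof --supports stmt-QuantumFields-20509 --as helper` (K3⁶; count-neutral).  Imports BY NAME this seat's `…N15FullPropagatorEntry2Rows` (FILE 4: `hasMaj_shiftDefect_fullG`,
`hasMaj_fshift`, `symbOp_sTinv_sub_one_eq`; through it FILES 1–3, dag-n15-a parts 42∕66, [B6] carrier facts) and n15-b's B2 `…N15BackgroundPairSpace` (`stack`, `projO`,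
`projO_none_comp_stack`; through it B1a `bgPropV`, `mulVecLin_toMatrix'(_rect)`); nothing in the tree is modified.

WHY.  (§1) FILE 1∕2's closed system and identification take the dressed entry 0 through its RIGHT fixed-point equation `E₀ = G + E₀W` ((3.65) right form); the lineage's object
is n15-b's LEFT Neumann `X̂ = (1 − ĜV̂)⁻¹Ĝ` (`bgPropV_fix`: `X̂ = Ĝ + ĜV̂X̂`).  §1 proves the right form `X̂ = Ĝ + X̂V̂Ĝ` under the SAME unit hypothesis (matrix identity
`(1 − T)⁻¹K = K + (1 − T)⁻¹TK`, `TK = K[V̂][Ĝ]`) and its `pr₀` component `E₀ = G + E₀∘(V̂∘Ĝ)` for the stacked layer `Ĝ = stack G D` — so `hE0` holds for the lineage's own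
dressed propagator with `W = V̂ ∘ stack G D`.  (§2) FILE 3's ★★ `hasMaj_idef_entry2_of_letters` INSTANTIATED on the torus family of record at Bałaban's full `U ≡ 1` propagator:
`S_ν = gOp∘fgradAdj (L^k) (bshiftEquiv ν)` (= `G∘ρ(n(s_ν⁻¹ − 1))`, FILE 4 §1) at both spacings with the (1.110) majorants (dag-n15-a part 42), shifts `pull (bshiftEquiv μ)` with cost
`e^{δ}` (FILE 4 §2), the shift-defect row letter from FILE 4 ★★ (part 66 inside); DISPLAYED at the common rate `δ`: the `U ≡ 1` entry-2 η-defect `𝔇(G′∇′_ν*, G∇_ν*) ≤ m_S e^{−δd}`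
(dag-n15-a's entry 2, parts 64–65 in flight — their `T2`), the dressed entry 0 of the fine spacing and its η-defect (the species' pair-space letters, V0), the by-parts multipliers and
translated coefficients (diagonal letters of (3.35) type) with the coarse shift intertwiners.  The bound is FILE 3's VERBATIM at rate `δ∕6`; every term carries exactly one of
`m_S, m₀, o, o₁, a₀(L^k)^{−α}`.

CONTENTS ([folklore] bookkeeping; 0 def).
* §1 `bgPropV_fix_right`, `projO_bgPropV_fix_right`.
* §2 ★★ **`hasMaj_idef_entry2_fullG_of_letters`** (`∀ δ₁ > 0 ∃ δ ≤ δ₁, β_S, c_T, C_T > 0 ∀ (m_T, k ≥ 1, m) ∀ letters …`).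

HONEST FRAMING ∕ LIMITS.  `U ≡ 1` torus family at fixed coupling `b`; the species' letters and the `U ≡ 1` entry-2 defect are DISPLAYED hypotheses (the latter is dag-n15-a's lane);
constants crude and ours; this is the entry-2 component of the located (G5) knit, not a (3.42) face by name.  NE2⁺ NOT PRINTED, NOT proved, not claimed; count-neutral (typed 28∕28 ·
discharged 5∕27 of record unchanged); N15 NOT discharged; one finite T⁴ at fixed ε — NOT ℝ⁴, NOT infinite volume, NOT OS, NOT a mass gap, NOT Clay.
-/

noncomputable section

open scoped BigOperators
open Finset

namespace Summit.QuantumFields.YangMills.BalabanUVNodes.N15.BackgroundLayer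

open Literature.MathematicalPhysics.QuantumFieldTheory.Balaban1983to89
open Literature.MathematicalPhysics.QuantumFieldTheory.Balaban1983to89.B11SectG (BlockNorm HasMaj RowSum hasMaj_comp hasMaj_comp_exp)
open Literature.MathematicalPhysics.QuantumFieldTheory.Balaban1983to89.T4EtaRateDefect (idef idef_apply idef_comp idef_add)
open Literature.MathematicalPhysics.QuantumFieldTheory.Balaban1983to89.T4EtaRateCoeffDefect (pull pull_apply diagK diagK_nonneg)
open Literature.MathematicalPhysics.QuantumFieldTheory.Balaban1983to89.B6RandomWalk (Triangle254)
open Literature.MathematicalPhysics.QuantumFieldTheory.Balaban1983to89.B11AxialTransport190 (abs_le_loc_ofBlocks loc_ofBlocks_le)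
open Literature.MathematicalPhysics.QuantumFieldTheory.Balaban1983to89.B9Eq3130MatrixLetters (hasMaj_id_ofBlocks)
open Literature.MathematicalPhysics.QuantumFieldTheory.Balaban1983to89.B5Prop11Plancherel (Tor fine unitVec)
open Literature.MathematicalPhysics.QuantumFieldTheory.Balaban1983to89.B5SiteBridgeP12 (MP)
open Literature.MathematicalPhysics.QuantumFieldTheory.Balaban1983to89.B6UnitTorusCarrier (unitTorusGeo triangle254_unitTorusGeo rowSum_unitTorusGeo unitTorusGeo_dist_nonneg)
open Literature.MathematicalPhysics.QuantumFieldTheory.King1986.Torus (blockOf tdistT tdistT_nonneg tdistT_self tdistT_symm tdistT_triangle)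
open Summit.QuantumFields.YangMills.BalabanUVNodes.N15.MatrixSpecies (liftMap liftBlk)
open Summit.QuantumFields.YangMills.BalabanUVNodes.N15.BackgroundModel (kappa_ofBlocks)
open Summit.QuantumFields.YangMills.BalabanUVNodes.N15.SiteLayer (hasMaj_exp_comp_diagK hasMaj_diagK_comp_exp hasMaj_add_exp hasMaj_exp_mono)
open Summit.QuantumFields.YangMills.BalabanUVNodes.N15.TwoGrid (gOp symbOp sT sTinv sD symbOp_single_apply hasMaj_divSteps_pair ineq110_114_pair
  hasMaj_gDivAdj_of_ineq paramsOf hasMaj_rate_mono)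
open Summit.QuantumFields.YangMills.BalabanUVNodes.N15.VectorPiece (blkFine kingPrV kingPrV_eq blkFine_comp_kingPrV bshiftV bshiftV_apply bshiftEquiv bshiftEquiv_apply
  bshiftEquiv_symm_apply)

variable {d : ℕ}

/-! ## §1 The RIGHT fixed-point equation of the lineage's constructed propagator: `X̂ = Ĝ + X̂∘V̂∘Ĝ`, `pr₀X̂ = G + (pr₀X̂)∘(V̂∘Ĝ)` -/

section RightFix

variable {X X₂ : Type} [Fintype X] [Fintype X₂] [DecidableEq X] [DecidableEq X₂]

/-- **(3.65), RIGHT FORM, BY CONSTRUCTION**: n15-b's constructed propagator `X(V̂) = (1 − ĜV̂)⁻¹Ĝ` satisfies `X(V̂) = Ĝ + X(V̂)∘V̂∘Ĝ` whenever `1 − [ĜV̂]` is a unit (no unit hypothesis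
on `1 − [V̂Ĝ]` is needed: `(1 − T)⁻¹K = K + (1 − T)⁻¹TK`, `TK = K[V̂][Ĝ]`). [cite: Balaban1985BackgroundPropagators, (3.65) p.402 («G′(U′U) = G′(U) + G′(U′U)V′(A)G′(U)»: shape)] -/
theorem bgPropV_fix_right {G : (X → ℝ) →ₗ[ℝ] (X₂ → ℝ)} {V : (X₂ → ℝ) →ₗ[ℝ] (X → ℝ)} (hunit : IsUnit (1 - LinearMap.toMatrix' (G ∘ₗ V))) :
    bgPropV G V = G + bgPropV G V ∘ₗ (V ∘ₗ G) := by
  set T := LinearMap.toMatrix' (G ∘ₗ V) with hT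
  set K := LinearMap.toMatrix' G with hK
  have hdet := (Matrix.isUnit_iff_isUnit_det _).1 hunit
  have hTK : K * LinearMap.toMatrix' (V ∘ₗ G) = T * K := by
    rw [hT, hK, LinearMap.toMatrix'_comp, LinearMap.toMatrix'_comp, Matrix.mul_assoc]
  have h1 : (1 - T)⁻¹ * ((1 - T) * K) = K := by
    rw [← Matrix.mul_assoc, Matrix.nonsing_inv_mul _ hdet, Matrix.one_mul]
  rw [Matrix.sub_mul, Matrix.one_mul, Matrix.mul_sub, sub_eq_iff_eq_add] at h1
  have h : (1 - T)⁻¹ * K = K + (1 - T)⁻¹ * K * LinearMap.toMatrix' (V ∘ₗ G) := by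
    rw [Matrix.mul_assoc, hTK, ← Matrix.mul_assoc]
    conv_lhs => rw [h1]
    rw [Matrix.mul_assoc]
  unfold bgPropV
  rw [← hT, ← hK]
  conv_lhs => rw [h]
  rw [Matrix.mulVecLin_add, Matrix.mulVecLin_mul, hK, mulVecLin_toMatrix'_rect, mulVecLin_toMatrix']

variable {J : Type} {F : Type} [AddCommGroup F] [Module ℝ F]

/-- **THE DRESSED ENTRY 0 SOLVES THE RIGHT FIXED-POINT EQUATION**: with `E₀ := pr₀ ∘ X(V̂)` for the stacked `U ≡ 1` layer `Ĝ = stack G D` and `W := V̂ ∘ Ĝ` (the operator of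
(3.63)–(3.64) acting AFTER the propagator), `E₀ = G + E₀ ∘ W` — the hypothesis `hE0` of `…TupleCalculus.e2_closed_system` ∕ `…Entry2ByParts.e0_comp_fgradAdj_eq_e2ByParts` for the
lineage's object. [cite: Balaban1985BackgroundPropagators, (3.64)–(3.65) p.402 (mechanism)] -/
theorem projO_bgPropV_fix_right [Fintype J] [DecidableEq J] {G : (X → ℝ) →ₗ[ℝ] (X → ℝ)} {D : J → (X → ℝ) →ₗ[ℝ] (X → ℝ)}
    {V : (X × Option J → ℝ) →ₗ[ℝ] (X → ℝ)} (hunit : IsUnit (1 - LinearMap.toMatrix' (stack G D ∘ₗ V))) :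
    projO none ∘ₗ bgPropV (stack G D) V = G + (projO none ∘ₗ bgPropV (stack G D) V) ∘ₗ (V ∘ₗ stack G D) := by
  conv_lhs => rw [bgPropV_fix_right hunit]
  rw [LinearMap.comp_add, projO_none_comp_stack, LinearMap.comp_assoc]

end RightFix

/-! ## §2 ★★ The η-defect of the by-parts dressed entry 2 AT BAŁABAN's FULL `U ≡ 1` PROPAGATOR, modulo the `U ≡ 1` entry-2 defect and the species' letters -/

section Torus

variable {L : ℕ} [NeZero L]

/-- ★★ **THE η-DEFECT OF THE BY-PARTS DRESSED ENTRY 2 AT BAŁABAN's FULL `U ≡ 1` PROPAGATOR** (torus family of record `M_μ = 2L^{m_T}`, spacings `L^{−k}` ∕ `L^{−m−k}`, King's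
pairing; odd `L ≥ 3`, `b > 0`, `0 ≤ α < 1`): for every `δ₁ > 0` there are `δ ∈ (0, δ₁]` and constants `β_S, c_T, C_T > 0` such that for every index and every species datum
DISPLAYED at rate `δ` — the dressed entry 0 of the fine spacing `E₀′ ≤ β₀e^{−δd}` and its η-defect `𝔇(E₀′,E₀) ≤ m₀e^{−δd}`, the by-parts multipliers `R̃, R̃′ ≤ diagK r`,
`𝔇(R̃′,R̃) ≤ diagK o`, the translated coefficient operators `C^a_μ, C^b_μ` (both spacings, `≤ diagK a₀`, defects `≤ diagK o`), the coarse shift intertwiners `S_{+μ}C^a_μ = C^{a+}_μS_{+μ}`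
with `C^{a+}_μ − C^a_μ ≤ diagK o₁`, and THE `U ≡ 1` ENTRY-2 η-DEFECT `𝔇(G′∇′_ν*, G∇_ν*) ≤ m_S e^{−δd}` (dag-n15-a's entry 2, in flight) — and the smallness `q = R c_r² < 1`
(`R = rowConst (d+1) β_S c_T a₀ c_r`, `c_r = latticeConst(d+1, δ∕6)`: a condition on the coefficient size `a₀`), the by-parts entry-2 objects `E₂ = B̂(1+K̂)⁻¹` built on
`S_ν = gOp∘∇_ν*` (`∇_ν* = fgradAdj (L^k) (bshiftEquiv ν)` = Bałaban's `ρ(n(s_ν⁻¹ − 1))`, FILE 4 §1) obey `…Entry2Letters.hasMaj_idef_entry2_of_letters`'s bound VERBATIM at rate `δ∕6`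
with `β_S` = the (1.110) constant, `c_T = e^{δ}`, `m_T = C_T(o₁ + a₀(L^k)^{−α})` (FILE 4 ★★).  Every `U ≡ 1` plain letter is a tree theorem (dag-n15-a parts 42∕66); NO mixed piece
`∇G∇*` anywhere.  With FILE 2's `e0_comp_fgradAdj_eq_e2ByParts` + §1's `projO_bgPropV_fix_right` this is the η-rate of `G(U)∇_ν*` for the lineage's first-order species once
`𝔇(E₀′,E₀)` (V0) and `m_S` (entry 2) are supplied. [cite: Balaban1985BackgroundPropagators, Thm 3.1 (3.42) p.397 (entry «G(U)∇*»: shape) + (3.64)–(3.65) p.402 (mechanism); Balaban1984PropagatorsI, Prop. 1.2 (1.110)–(1.111) p.35] -/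
theorem hasMaj_idef_entry2_fullG_of_letters (hLodd : Odd L) (hL2 : 2 ≤ L) {b : ℝ} (hb : 0 < b) {α : ℝ} (hα0 : 0 ≤ α) (hα1 : α < 1) {δ₁ : ℝ} (hδ₁ : 0 < δ₁) :
    ∃ δ βS cT CT : ℝ, 0 < δ ∧ δ ≤ δ₁ ∧ 0 < βS ∧ 0 < cT ∧ 0 < CT ∧ ∀ (mT k m : ℕ) (_hk : 1 ≤ k) (hL : Odd L ∧ 1 < L)
      (E0 Rt : (Tor (fine (L ^ k) (MP (paramsOf d L mT k hL))) × Fin (d + 1) → ℝ) →ₗ[ℝ] (Tor (fine (L ^ k) (MP (paramsOf d L mT k hL))) × Fin (d + 1) → ℝ))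
      (Ca Cap Cb : Fin (d + 1) →
        (Tor (fine (L ^ k) (MP (paramsOf d L mT k hL))) × Fin (d + 1) → ℝ) →ₗ[ℝ] (Tor (fine (L ^ k) (MP (paramsOf d L mT k hL))) × Fin (d + 1) → ℝ))
      (E0' Rt' : (Tor (fine (L ^ m * L ^ k) (MP (paramsOf d L mT k hL))) × Fin (d + 1) → ℝ) →ₗ[ℝ]
        (Tor (fine (L ^ m * L ^ k) (MP (paramsOf d L mT k hL))) × Fin (d + 1) → ℝ))
      (Ca' Cb' : Fin (d + 1) → (Tor (fine (L ^ m * L ^ k) (MP (paramsOf d L mT k hL))) × Fin (d + 1) → ℝ) →ₗ[ℝ]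
        (Tor (fine (L ^ m * L ^ k) (MP (paramsOf d L mT k hL))) × Fin (d + 1) → ℝ))
      (β₀ r a₀ o o₁ mS m₀ : ℝ), 0 ≤ β₀ → 0 ≤ r → 0 ≤ a₀ → 0 ≤ o → 0 ≤ o₁ → 0 ≤ mS → 0 ≤ m₀ →
      -- the `U ≡ 1` ENTRY-2 η-DEFECT (dag-n15-a's entry 2), displayed
      (∀ ν, HasMaj (BlockNorm.ofBlocks (unitTorusGeo L k (MP (paramsOf d L mT k hL))) (blkFine L k (MP (paramsOf d L mT k hL))))
        (BlockNorm.ofBlocks (unitTorusGeo L k (MP (paramsOf d L mT k hL))) (blkFine L k (MP (paramsOf d L mT k hL)) ∘ kingPrV L k m (MP (paramsOf d L mT k hL))))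
        (idef (pull (kingPrV L k m (MP (paramsOf d L mT k hL)))) (pull (kingPrV L k m (MP (paramsOf d L mT k hL))))
          (gOp (MP (paramsOf d L mT k hL)) (L ^ m * L ^ k) b ∘ₗ fgradAdj ((L ^ m * L ^ k : ℕ) : ℝ) (bshiftEquiv (MP (paramsOf d L mT k hL)) (L ^ m * L ^ k) ν))
          (gOp (MP (paramsOf d L mT k hL)) (L ^ k) b ∘ₗ fgradAdj ((L ^ k : ℕ) : ℝ) (bshiftEquiv (MP (paramsOf d L mT k hL)) (L ^ k) ν)))
        (fun y y' => mS * Real.exp (-(δ * tdistT (MP (paramsOf d L mT k hL)) y y')))) →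
      -- the dressed entry 0 (fine) and its η-defect, displayed
      HasMaj (BlockNorm.ofBlocks (unitTorusGeo L k (MP (paramsOf d L mT k hL))) (blkFine L k (MP (paramsOf d L mT k hL)) ∘ kingPrV L k m (MP (paramsOf d L mT k hL))))
        (BlockNorm.ofBlocks (unitTorusGeo L k (MP (paramsOf d L mT k hL))) (blkFine L k (MP (paramsOf d L mT k hL)) ∘ kingPrV L k m (MP (paramsOf d L mT k hL)))) E0'
        (fun y y' => β₀ * Real.exp (-(δ * tdistT (MP (paramsOf d L mT k hL)) y y'))) →
      HasMaj (BlockNorm.ofBlocks (unitTorusGeo L k (MP (paramsOf d L mT k hL))) (blkFine L k (MP (paramsOf d L mT k hL))))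
        (BlockNorm.ofBlocks (unitTorusGeo L k (MP (paramsOf d L mT k hL))) (blkFine L k (MP (paramsOf d L mT k hL)) ∘ kingPrV L k m (MP (paramsOf d L mT k hL))))
        (idef (pull (kingPrV L k m (MP (paramsOf d L mT k hL)))) (pull (kingPrV L k m (MP (paramsOf d L mT k hL)))) E0' E0)
        (fun y y' => m₀ * Real.exp (-(δ * tdistT (MP (paramsOf d L mT k hL)) y y'))) →
      -- the by-parts multipliers, displayed
      HasMaj (BlockNorm.ofBlocks (unitTorusGeo L k (MP (paramsOf d L mT k hL))) (blkFine L k (MP (paramsOf d L mT k hL))))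
        (BlockNorm.ofBlocks (unitTorusGeo L k (MP (paramsOf d L mT k hL))) (blkFine L k (MP (paramsOf d L mT k hL)))) Rt (diagK fun _ => r) →
      HasMaj (BlockNorm.ofBlocks (unitTorusGeo L k (MP (paramsOf d L mT k hL))) (blkFine L k (MP (paramsOf d L mT k hL)) ∘ kingPrV L k m (MP (paramsOf d L mT k hL))))
        (BlockNorm.ofBlocks (unitTorusGeo L k (MP (paramsOf d L mT k hL))) (blkFine L k (MP (paramsOf d L mT k hL)) ∘ kingPrV L k m (MP (paramsOf d L mT k hL)))) Rt'
        (diagK fun _ => r) →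
      HasMaj (BlockNorm.ofBlocks (unitTorusGeo L k (MP (paramsOf d L mT k hL))) (blkFine L k (MP (paramsOf d L mT k hL))))
        (BlockNorm.ofBlocks (unitTorusGeo L k (MP (paramsOf d L mT k hL))) (blkFine L k (MP (paramsOf d L mT k hL)) ∘ kingPrV L k m (MP (paramsOf d L mT k hL))))
        (idef (pull (kingPrV L k m (MP (paramsOf d L mT k hL)))) (pull (kingPrV L k m (MP (paramsOf d L mT k hL)))) Rt' Rt) (diagK fun _ => o) →
      -- the translated coefficient operators, displayed
      (∀ μ, HasMaj (BlockNorm.ofBlocks (unitTorusGeo L k (MP (paramsOf d L mT k hL))) (blkFine L k (MP (paramsOf d L mT k hL))))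
        (BlockNorm.ofBlocks (unitTorusGeo L k (MP (paramsOf d L mT k hL))) (blkFine L k (MP (paramsOf d L mT k hL)))) (Ca μ) (diagK fun _ => a₀)) →
      (∀ μ, HasMaj (BlockNorm.ofBlocks (unitTorusGeo L k (MP (paramsOf d L mT k hL))) (blkFine L k (MP (paramsOf d L mT k hL)) ∘ kingPrV L k m (MP (paramsOf d L mT k hL))))
        (BlockNorm.ofBlocks (unitTorusGeo L k (MP (paramsOf d L mT k hL))) (blkFine L k (MP (paramsOf d L mT k hL)) ∘ kingPrV L k m (MP (paramsOf d L mT k hL)))) (Ca' μ)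
        (diagK fun _ => a₀)) →
      (∀ μ, HasMaj (BlockNorm.ofBlocks (unitTorusGeo L k (MP (paramsOf d L mT k hL))) (blkFine L k (MP (paramsOf d L mT k hL))))
        (BlockNorm.ofBlocks (unitTorusGeo L k (MP (paramsOf d L mT k hL))) (blkFine L k (MP (paramsOf d L mT k hL)))) (Cb μ) (diagK fun _ => a₀)) →
      (∀ μ, HasMaj (BlockNorm.ofBlocks (unitTorusGeo L k (MP (paramsOf d L mT k hL))) (blkFine L k (MP (paramsOf d L mT k hL)) ∘ kingPrV L k m (MP (paramsOf d L mT k hL))))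
        (BlockNorm.ofBlocks (unitTorusGeo L k (MP (paramsOf d L mT k hL))) (blkFine L k (MP (paramsOf d L mT k hL)) ∘ kingPrV L k m (MP (paramsOf d L mT k hL)))) (Cb' μ)
        (diagK fun _ => a₀)) →
      (∀ μ, HasMaj (BlockNorm.ofBlocks (unitTorusGeo L k (MP (paramsOf d L mT k hL))) (blkFine L k (MP (paramsOf d L mT k hL))))
        (BlockNorm.ofBlocks (unitTorusGeo L k (MP (paramsOf d L mT k hL))) (blkFine L k (MP (paramsOf d L mT k hL)) ∘ kingPrV L k m (MP (paramsOf d L mT k hL))))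
        (idef (pull (kingPrV L k m (MP (paramsOf d L mT k hL)))) (pull (kingPrV L k m (MP (paramsOf d L mT k hL)))) (Ca' μ) (Ca μ)) (diagK fun _ => o)) →
      (∀ μ, HasMaj (BlockNorm.ofBlocks (unitTorusGeo L k (MP (paramsOf d L mT k hL))) (blkFine L k (MP (paramsOf d L mT k hL))))
        (BlockNorm.ofBlocks (unitTorusGeo L k (MP (paramsOf d L mT k hL))) (blkFine L k (MP (paramsOf d L mT k hL)) ∘ kingPrV L k m (MP (paramsOf d L mT k hL))))
        (idef (pull (kingPrV L k m (MP (paramsOf d L mT k hL)))) (pull (kingPrV L k m (MP (paramsOf d L mT k hL)))) (Cb' μ) (Cb μ)) (diagK fun _ => o)) →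
      -- the coarse shift intertwiners and the one-step oscillation of the forward coefficients, displayed
      (∀ μ, pull ⇑(bshiftEquiv (MP (paramsOf d L mT k hL)) (L ^ k) μ) ∘ₗ Ca μ = Cap μ ∘ₗ pull ⇑(bshiftEquiv (MP (paramsOf d L mT k hL)) (L ^ k) μ)) →
      (∀ μ, HasMaj (BlockNorm.ofBlocks (unitTorusGeo L k (MP (paramsOf d L mT k hL))) (blkFine L k (MP (paramsOf d L mT k hL))))
        (BlockNorm.ofBlocks (unitTorusGeo L k (MP (paramsOf d L mT k hL))) (blkFine L k (MP (paramsOf d L mT k hL)))) (Cap μ - Ca μ) (diagK fun _ => o₁)) →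
      -- the smallness (a condition on the coefficient size `a₀`)
      1 * rowConst (Fintype.card (Fin (d + 1))) βS cT a₀ (B4Sect5Proof.latticeConst (d + 1) (δ / 6)) * B4Sect5Proof.latticeConst (d + 1) (δ / 6) *
        B4Sect5Proof.latticeConst (d + 1) (δ / 6) < 1 →
      HasMaj (BlockNorm.ofBlocks (unitTorusGeo L k (MP (paramsOf d L mT k hL))) (liftBlk (blkFine L k (MP (paramsOf d L mT k hL))) (Fin (d + 1))))
        (BlockNorm.ofBlocks (unitTorusGeo L k (MP (paramsOf d L mT k hL))) (blkFine L k (MP (paramsOf d L mT k hL)) ∘ kingPrV L k m (MP (paramsOf d L mT k hL))))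
        (idef (pull (liftMap (kingPrV L k m (MP (paramsOf d L mT k hL))) (Fin (d + 1)))) (pull (kingPrV L k m (MP (paramsOf d L mT k hL))))
          (e2ByParts
            (bopOf (fun ν => gOp (MP (paramsOf d L mT k hL)) (L ^ m * L ^ k) b ∘ₗ
              fgradAdj ((L ^ m * L ^ k : ℕ) : ℝ) (bshiftEquiv (MP (paramsOf d L mT k hL)) (L ^ m * L ^ k) ν)) E0' Rt')
            (krowOf (fun ν => gOp (MP (paramsOf d L mT k hL)) (L ^ m * L ^ k) b ∘ₗ
              fgradAdj ((L ^ m * L ^ k : ℕ) : ℝ) (bshiftEquiv (MP (paramsOf d L mT k hL)) (L ^ m * L ^ k) ν))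
              (fun μ => pull ⇑(bshiftEquiv (MP (paramsOf d L mT k hL)) (L ^ m * L ^ k) μ)) Ca' Cb'))
          (e2ByParts
            (bopOf (fun ν => gOp (MP (paramsOf d L mT k hL)) (L ^ k) b ∘ₗ fgradAdj ((L ^ k : ℕ) : ℝ) (bshiftEquiv (MP (paramsOf d L mT k hL)) (L ^ k) ν)) E0 Rt)
            (krowOf (fun ν => gOp (MP (paramsOf d L mT k hL)) (L ^ k) b ∘ₗ fgradAdj ((L ^ k : ℕ) : ℝ) (bshiftEquiv (MP (paramsOf d L mT k hL)) (L ^ k) ν))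
              (fun μ => pull ⇑(bshiftEquiv (MP (paramsOf d L mT k hL)) (L ^ k) μ)) Ca Cb)))
        (fun y y' => (srcConst (Fintype.card (Fin (d + 1))) βS β₀ r (B4Sect5Proof.latticeConst (d + 1) (δ / 6)) *
              (1 * (1 - 1 * rowConst (Fintype.card (Fin (d + 1))) βS cT a₀ (B4Sect5Proof.latticeConst (d + 1) (δ / 6)) * B4Sect5Proof.latticeConst (d + 1) (δ / 6) *
                B4Sect5Proof.latticeConst (d + 1) (δ / 6))⁻¹) *
              mKOf (Fintype.card (Fin (d + 1))) βS cT a₀ mS o (CT * (o₁ + a₀ * ((L ^ k : ℕ) : ℝ) ^ (-α))) (B4Sect5Proof.latticeConst (d + 1) (δ / 6)) *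
              B4Sect5Proof.latticeConst (d + 1) (δ / 6) *
              (1 * (1 - 1 * rowConst (Fintype.card (Fin (d + 1))) βS cT a₀ (B4Sect5Proof.latticeConst (d + 1) (δ / 6)) * B4Sect5Proof.latticeConst (d + 1) (δ / 6) *
                B4Sect5Proof.latticeConst (d + 1) (δ / 6))⁻¹) *
              B4Sect5Proof.latticeConst (d + 1) (δ / 6) * B4Sect5Proof.latticeConst (d + 1) (δ / 6) +
            mBOf (Fintype.card (Fin (d + 1))) βS β₀ r (B4Sect5Proof.latticeConst (d + 1) (δ / 6)) mS m₀ o *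
              (1 * (1 - 1 * rowConst (Fintype.card (Fin (d + 1))) βS cT a₀ (B4Sect5Proof.latticeConst (d + 1) (δ / 6)) * B4Sect5Proof.latticeConst (d + 1) (δ / 6) *
                B4Sect5Proof.latticeConst (d + 1) (δ / 6))⁻¹) *
              B4Sect5Proof.latticeConst (d + 1) (δ / 6)) *
          Real.exp (-(δ / 6 * tdistT (MP (paramsOf d L mT k hL)) y y'))) := by
  have hL : Odd L ∧ 1 < L := ⟨hLodd, by omega⟩
  have hL0 : 0 < L := by omega
  obtain ⟨δ₂, C₂, hδ₂, hC₂, HT⟩ := hasMaj_shiftDefect_fullG (d := d) hLodd hL2 hb hα0 hα1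
  obtain ⟨δ₀, C₀, Cα, Cε, Cαε, hδ₀, hC₀, HP⟩ := ineq110_114_pair (d := d) hL hb
  set δ : ℝ := min (min δ₀ δ₂) δ₁ with hδdef
  have hδ : 0 < δ := lt_min (lt_min hδ₀ hδ₂) hδ₁
  have hδ₀' : δ ≤ δ₀ := (min_le_left _ _).trans (min_le_left _ _)
  have hδ₂' : δ ≤ δ₂ := (min_le_left _ _).trans (min_le_right _ _)
  refine ⟨δ, C₀, Real.exp δ, C₂, hδ, min_le_right _ _, hC₀, Real.exp_pos δ, hC₂, ?_⟩
  intro mT k m hk hL' E0 Rt Ca Cap Cb E0' Rt' Ca' Cb' β₀ r a₀ o o₁ mS m₀ hβ₀ hr ha₀ ho ho₁ hmS hm₀ hDS hE' hDE hR hR' hDR hCa hCa' hCb hCb' hDCa hDCb hCaS hOsc hq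
  have hn1 : 1 ≤ L ^ k := Nat.one_le_pow _ _ hL0
  have hn1' : 1 ≤ L ^ m * L ^ k := Nat.one_le_iff_ne_zero.mpr (by positivity)
  have hnpos : (0 : ℝ) < ((L ^ k : ℕ) : ℝ) := by exact_mod_cast Nat.pos_of_ne_zero (by positivity)
  have hrα : 0 ≤ ((L ^ k : ℕ) : ℝ) ^ (-α) := Real.rpow_nonneg hnpos.le _
  -- the [B6] carrier data of the unit torus
  have hσ : 0 < δ / 6 := by positivity
  have htri := triangle254_unitTorusGeo (L := L) (k := k) (M := MP (paramsOf d L mT k hL'))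
  have hd : ∀ a c : (unitTorusGeo L k (MP (paramsOf d L mT k hL'))).Site, 0 ≤ (unitTorusGeo L k (MP (paramsOf d L mT k hL'))).dist a c :=
    unitTorusGeo_dist_nonneg L k (MP (paramsOf d L mT k hL'))
  have hd0 : ∀ y : (unitTorusGeo L k (MP (paramsOf d L mT k hL'))).Site, (unitTorusGeo L k (MP (paramsOf d L mT k hL'))).dist y y = 0 :=
    fun y => tdistT_self (MP (paramsOf d L mT k hL')) y
  have hrow := rowSum_unitTorusGeo (L := L) (k := k) (M := MP (paramsOf d L mT k hL')) hσ
  have hcr : 0 ≤ B4Sect5Proof.latticeConst (d + 1) (δ / 6) := B4Sect5Proof.latticeConst_nonneg _ hσ.le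
  -- the (1.110) majorants of `S_ν = G∇_ν*` at both spacings
  obtain ⟨HP1, HP2⟩ := HP mT k m hk
  have hS : ∀ ν, HasMaj (BlockNorm.ofBlocks (unitTorusGeo L k (MP (paramsOf d L mT k hL'))) (blkFine L k (MP (paramsOf d L mT k hL'))))
      (BlockNorm.ofBlocks (unitTorusGeo L k (MP (paramsOf d L mT k hL'))) (blkFine L k (MP (paramsOf d L mT k hL'))))
      (gOp (MP (paramsOf d L mT k hL')) (L ^ k) b ∘ₗ fgradAdj ((L ^ k : ℕ) : ℝ) (bshiftEquiv (MP (paramsOf d L mT k hL')) (L ^ k) ν))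
      (fun y y' => C₀ * Real.exp (-(δ * tdistT (MP (paramsOf d L mT k hL')) y y'))) := fun ν => by
    rw [← symbOp_sTinv_sub_one_eq]
    exact hasMaj_rate_mono hC₀.le hδ₀' (hasMaj_gDivAdj_of_ineq (MP (paramsOf d L mT k hL')) k (L ^ k) b hn1 HP1 hC₀.le ν)
  have hS' : ∀ ν, HasMaj (BlockNorm.ofBlocks (unitTorusGeo L k (MP (paramsOf d L mT k hL')))
        (blkFine L k (MP (paramsOf d L mT k hL')) ∘ kingPrV L k m (MP (paramsOf d L mT k hL'))))
      (BlockNorm.ofBlocks (unitTorusGeo L k (MP (paramsOf d L mT k hL'))) (blkFine L k (MP (paramsOf d L mT k hL')) ∘ kingPrV L k m (MP (paramsOf d L mT k hL'))))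
      (gOp (MP (paramsOf d L mT k hL')) (L ^ m * L ^ k) b ∘ₗ fgradAdj ((L ^ m * L ^ k : ℕ) : ℝ) (bshiftEquiv (MP (paramsOf d L mT k hL')) (L ^ m * L ^ k) ν))
      (fun y y' => C₀ * Real.exp (-(δ * tdistT (MP (paramsOf d L mT k hL')) y y'))) := fun ν => by
    rw [← symbOp_sTinv_sub_one_eq, blkFine_comp_kingPrV]
    exact hasMaj_rate_mono hC₀.le hδ₀' (hasMaj_gDivAdj_of_ineq (MP (paramsOf d L mT k hL')) k (L ^ m * L ^ k) b hn1' HP2 hC₀.le ν)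
  -- the shifts
  have hSh : ∀ μ, HasMaj (BlockNorm.ofBlocks (unitTorusGeo L k (MP (paramsOf d L mT k hL'))) (blkFine L k (MP (paramsOf d L mT k hL'))))
      (BlockNorm.ofBlocks (unitTorusGeo L k (MP (paramsOf d L mT k hL'))) (blkFine L k (MP (paramsOf d L mT k hL'))))
      (pull ⇑(bshiftEquiv (MP (paramsOf d L mT k hL')) (L ^ k) μ)) (fun y y' => Real.exp δ * Real.exp (-(δ * tdistT (MP (paramsOf d L mT k hL')) y y'))) := fun μ =>
    hasMaj_fshift (MP (paramsOf d L mT k hL')) k (L ^ k) hδ.le μ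
  have hSh' : ∀ μ, HasMaj (BlockNorm.ofBlocks (unitTorusGeo L k (MP (paramsOf d L mT k hL')))
        (blkFine L k (MP (paramsOf d L mT k hL')) ∘ kingPrV L k m (MP (paramsOf d L mT k hL'))))
      (BlockNorm.ofBlocks (unitTorusGeo L k (MP (paramsOf d L mT k hL'))) (blkFine L k (MP (paramsOf d L mT k hL')) ∘ kingPrV L k m (MP (paramsOf d L mT k hL'))))
      (pull ⇑(bshiftEquiv (MP (paramsOf d L mT k hL')) (L ^ m * L ^ k) μ)) (fun y y' => Real.exp δ * Real.exp (-(δ * tdistT (MP (paramsOf d L mT k hL')) y y'))) :=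
    fun μ => by
    rw [blkFine_comp_kingPrV]
    exact hasMaj_fshift (MP (paramsOf d L mT k hL')) k (L ^ m * L ^ k) hδ.le μ
  -- the shift-defect row letter (FILE 4)
  have hmT : 0 ≤ C₂ * (o₁ + a₀ * ((L ^ k : ℕ) : ℝ) ^ (-α)) := by positivity
  have hDSh : ∀ μ, HasMaj (BlockNorm.ofBlocks (unitTorusGeo L k (MP (paramsOf d L mT k hL'))) (liftBlk (blkFine L k (MP (paramsOf d L mT k hL'))) (Fin (d + 1))))
      (BlockNorm.ofBlocks (unitTorusGeo L k (MP (paramsOf d L mT k hL'))) (blkFine L k (MP (paramsOf d L mT k hL')) ∘ kingPrV L k m (MP (paramsOf d L mT k hL'))))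
      (idef (pull (kingPrV L k m (MP (paramsOf d L mT k hL')))) (pull (kingPrV L k m (MP (paramsOf d L mT k hL'))))
          (pull ⇑(bshiftEquiv (MP (paramsOf d L mT k hL')) (L ^ m * L ^ k) μ)) (pull ⇑(bshiftEquiv (MP (paramsOf d L mT k hL')) (L ^ k) μ)) ∘ₗ
        (Ca μ ∘ₗ sumJ fun ν => gOp (MP (paramsOf d L mT k hL')) (L ^ k) b ∘ₗ fgradAdj ((L ^ k : ℕ) : ℝ) (bshiftEquiv (MP (paramsOf d L mT k hL')) (L ^ k) ν)))
      (fun y y' => C₂ * (o₁ + a₀ * ((L ^ k : ℕ) : ℝ) ^ (-α)) * Real.exp (-(δ * tdistT (MP (paramsOf d L mT k hL')) y y'))) := fun μ =>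
    hasMaj_rate_mono hmT hδ₂' (HT mT k m hk hL' μ (Ca μ) (Cap μ) a₀ o₁ ha₀ ho₁ (hCaS μ) (hCa μ) (hOsc μ))
  exact hasMaj_idef_entry2_of_letters (blkFine L k (MP (paramsOf d L mT k hL'))) (kingPrV L k m (MP (paramsOf d L mT k hL'))) htri hd hd0 hrow hσ.le hcr
    (ρ := δ / 6) (by positivity) (by linarith) hC₀.le hβ₀ hr (Real.exp_pos δ).le ha₀ hmS hm₀ ho hmT
    hS hS' hE' hR hR' hSh hSh' hCa hCa' hCb hCb' hDS hDE hDR hDCa hDCb hDSh hq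

end Torus

end Summit.QuantumFields.YangMills.BalabanUVNodes.N15.BackgroundLayer

end
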